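import Literature.Barriers.QuantumFields.GrossWittenEquilibrium
import HarnessLib

/-!
# Proof of `GrossWittenLargeNFreeEnergy` (Johansson 1998, Lemma 2.1 [GW])

Sibling proof file of `GrossWittenTransition.lean` (`Literature/Barriers/QuantumFields/`, D-0021;
namespace `Literature.Barriers.QuantumFields`): the DISCHARGE
`theorem GrossWittenLargeNFreeEnergy_holds : GrossWittenLargeNFreeEnergy` of the named fact

  "If `f_n(γ) = n⁻² log G_n(γ)`, then `lim_{n→∞} f_n(γ) = f(γ) = γ²/4` if `0 ≤ γ ≤ 1`,
  `γ − 3/4 − (log γ)/2` if `γ > 1`" [cite: Johansson1998, Lemma 2.1],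

`G_n(γ) = E_n(exp(γ n ∑_j cos θ_j))` for the eigenvalue density
`(2π)⁻ⁿ(n!)⁻¹ ∏_{j<k}|e^{iθ_j} − e^{iθ_k}|²` on `[−π,π]ⁿ` (the large-`N` free energy of two-dimensional
`U(N)` lattice gauge theory, Gross–Witten 1980), stated in `GrossWittenTransition.lean` as
`∀ γ ≥ 0, Tendsto (fun n => gwFreeEnergyN n γ) atTop (𝓝 (gwFreeEnergy γ))`.

## The proof (layers 1–3, all in the tree, all sorry-free)

Not Johansson's route (§3: the loop equation (3.5) for the Cauchy transform of the one-point
function, the determinantal bound Lemma 3.1, normal families and Lemma 3.2), which would need the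
orthogonal-polynomial structure of the unitary ensemble, but the elementary potential-theoretic
reading of `G_n` as "the partition function of a Coulomb gas of unit charges on the unit circle with
logarithmic repulsion and an external potential" (Johansson, p. 65):

1. `Literature.Analysis.Potential.CircleLogKernel` — the angular logarithmic kernel
   `ℓ(v) = log|1 − e^{iv}|`, its Poisson regularisation `ℓ_r = log|1 − r e^{iv}|`
   (`ℓ + (log r)/2 ≤ ℓ_r`, `ℓ_r = −∑ rᵐ cos(mv)/m`), its Fourier moments (`∫ℓ = 0`, `∫ℓ cos = −π`),
   negative type of `ℓ_r` on finite measures, and the smoothing estimate `U_r ≤ U + M η(r)`,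
   `η(r) → 0`.
2. `GrossWittenCoulombGas` — for any Frostman datum (`μ ≤ M vol`, `γ cos + 2U^μ ≤ ℓ_F`,
   `∫(γ cos + 2U^μ) dμ = ℓ_F`): the UPPER bound on the Gibbs weight by regularisation + negative
   type + Frostman at each particle, the LOWER bound by Jensen under `μ^{⊗n}`, hence
   `gwFreeEnergyN n γ → γ ∫cos dμ + E(μ)`.
3. `GrossWittenEquilibrium` — the two Gross–Witten equilibrium measures as Frostman data
   [cite: Johansson1998, Lemma 3.2]: `(2π)⁻¹(1 + γ cos)` for `γ ≤ 1` (free energy `γ²/4`) and, for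
   `γ > 1`, the gapped measure written as the push-forward of the critical density under
   `T(β) = 2 arcsin (γ^{-1/2} sin (β/2))` (free energy `γ − 3/4 − (log γ)/2`).

The statement proved is the named fact verbatim (no weakening); its consequences recorded in
`GrossWittenTransition.lean` (`GrossWittenLargeNFreeEnergy.not_analyticAt`,
`.lt_of_strongContinuation`, `.not_isStrongCouplingExtrapolable`) thereby become unconditional.

## References

* K. Johansson, *The longest increasing subsequence in a random permutation and a unitary random
  matrix model*, Math. Res. Lett. 5 (1998) 63–82, doi:10.4310/mrl.1998.v5.n1.a6 — Lemma 2.1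
  (p. 66), p. 65, Lemma 3.2 and (3.8) (p. 71).
* D. J. Gross, E. Witten, *Possible third-order phase transition in the large-N lattice gauge
  theory*, Phys. Rev. D 21 (1980) 446–453.
-/

noncomputable section

open Filter Topology

namespace Literature.Barriers.QuantumFields

/-- **Johansson 1998, Lemma 2.1 [GW] — the Gross–Witten large-`N` free energy, PROVED**:
for every `γ ≥ 0`, `n⁻² log G_n(γ) → f(γ)` with `f(γ) = γ²/4` (`γ ≤ 1`), `γ − 3/4 − (log γ)/2`
(`γ > 1`). The limit along the Frostman datum of the phase containing `γ`
(`strongData`/`weakData`), whose free energy is `gwStrong γ`/`gwWeak γ`. [cite: Johansson1998, Lemma 2.1] -/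
theorem GrossWittenLargeNFreeEnergy_holds : GrossWittenLargeNFreeEnergy := by
  intro γ hγ
  rcases le_or_gt γ 1 with h1 | h1
  · have h := (strongData hγ h1).tendsto_gwFreeEnergyN
    rwa [strongData_freeEnergy hγ h1, ← gwFreeEnergy_of_le_one h1] at h
  · have h := (weakData h1).tendsto_gwFreeEnergyN
    rwa [weakData_freeEnergy h1, ← gwFreeEnergy_of_one_lt h1] at h

end Literature.Barriers.QuantumFields
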